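import Summits.Parity.BatemanHorn.Theorems.AlmostPrimeZerosSystemLSDRealSegmentNairSystem
import Literature.NumberTheory.LFunctions.MertensFormula
import HarnessLib

/-!
# Crux `DiscMajorantLog` (stmt-Parity-17114), line `Sketch`: stub `stub_realAxisFixedIntervalOfNair`

Support file for the registered skeleton `Cruxes/DiscMajorantLog/Lines/Sketch.lean` of the crux
`Summit.Parity.BatemanHorn.Theses.AlmostPrimeZeros.DiscMajorantLog` (line `Sketch`), stub
`stub_realAxisFixedIntervalOfNair`: the positive real segment of the disc majorant on every FIXED
interval `0 < t ≤ T`, for EVERY Bateman–Horn system `f = (f₁,…,f_k)`,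
`Σ_{0 ≤ n ≤ x} t^{s_f(n)} ≤ A·x·(log x)^{k(t−1)}` (`x ≥ x₀`, uniformly in `t ∈ (0, T]`), DERIVED from the
Nair–Tenenbaum "light" hypothesis `HN` (the registered closing form `nairTenenbaumLight` of the sibling crux
stmt-Parity-11292): for one polynomial `F` and every admissible multiplicative weight `G` with `G(p^v) ≤ A`,
`Σ_{1≤n≤N} G(F(n)) ≤ C·N·exp(Σ_{p≤N} (G(p) − 1)ρ_F(p)/p)` with `C` chosen before `G`.

Route (folklore bookkeeping around `HN`): shift `n ↦ m + n₀` so that all `fᵢ(m + n₀) ≥ 2`, and run `HN` on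
`F = (∏ fᵢ)(X + n₀)` (degree `Σ deg fᵢ ≥ 1`, root counts `ρ_F = ρ_f ≤ Σ deg fᵢ`, `ρ_F(p) < p`,
`ρ_F(p^a) ≤ deg F · M`, all from `…SystemLSDRealSegmentNairSystem`), with the weight
`G(m) = t^{Σ_p min(v_p(m), 2k)}` when `t ≥ 1` and `G(m) = t^{ω(m)}` when `t < 1`; in both cases `G(p) = t`,
`G(p^v) ≤ T^{2k}` and `t^{s_f(m+n₀)} ≤ G(F(m))`.  The exponent `(t − 1)·Σ_{p≤N} ρ_f(p)/p` is within `T·C_f` of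
`k(t−1) log log N` by Mertens along the system in both directions (`AZFG2020_tendsto_sum_sub_omega_div_holds`,
`exists_sum_rootCount_div_le`, and Mertens' second theorem with rate `Mertens.abs_primeRecipSum_sub_le`).
The finitely many `n ≤ n₀` contribute a constant, absorbed by `x (log x)^{k(t−1)} ≥ x (log x)^{−k} ≥ 1`.

No definitions; helpers live in the sub-namespace `…Sketch.RealAxisNair`.
-/

noncomputable section

namespace Summit.Parity.BatemanHorn.Cruxes.DiscMajorantLog.Sketch

open scoped BigOperators
open Polynomial Filter
open Literature.NumberTheory.Sieve
open Summit.Parity.BatemanHorn.Cruxes.SystemLSDRealSegment.BetaThinnedRootKernel.Nair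

namespace RealAxisNair

/-! ### The two weights -/

/-- The capped weight `G(m) = t^{Σ_p min(v_p(m), K)}` for `1 ≤ t ≤ T`, `K ≥ 1`: nonnegative, `G(1) = 1`,
multiplicative on coprime arguments, `G(p^v) ≤ T^K`, and `G(p) = t`. [folklore] -/
theorem cappedWeight_admissible {K : ℕ} (hK : 1 ≤ K) {t T : ℝ} (ht1 : 1 ≤ t) (htT : t ≤ T) :
    (∀ n : ℕ, 0 ≤ t ^ (n.factorization.sum fun _ v => min v K)) ∧
    t ^ ((1 : ℕ).factorization.sum fun _ v => min v K) = 1 ∧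
    (∀ m n : ℕ, m.Coprime n → t ^ ((m * n).factorization.sum fun _ v => min v K) =
        t ^ (m.factorization.sum fun _ v => min v K) * t ^ (n.factorization.sum fun _ v => min v K)) ∧
    (∀ p : ℕ, p.Prime → ∀ v : ℕ, 1 ≤ v → t ^ ((p ^ v).factorization.sum fun _ v => min v K) ≤ T ^ K) ∧
    (∀ p : ℕ, p.Prime → t ^ (p.factorization.sum fun _ v => min v K) = t) := by
  have ht0 : 0 ≤ t := zero_le_one.trans ht1
  refine ⟨fun n => pow_nonneg ht0 _, by simp, fun m n hmn => ?_, fun p hp v _ => ?_, fun p hp => ?_⟩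
  · rcases eq_or_ne m 0 with rfl | hm
    · obtain rfl : n = 1 := (Nat.coprime_zero_left n).1 hmn
      simp
    rcases eq_or_ne n 0 with rfl | hn
    · obtain rfl : m = 1 := (Nat.coprime_zero_right m).1 hmn
      simp
    rw [cappedK_mul K hm hn hmn, pow_add]
  · rw [cappedK_prime_pow K hp]
    calc t ^ min v K ≤ t ^ K := pow_le_pow_right₀ ht1 (min_le_right _ _)
      _ ≤ T ^ K := pow_le_pow_left₀ ht0 htT K
  · have h := cappedK_prime_pow K hp 1
    rw [pow_one] at h
    rw [h, min_eq_left hK, pow_one]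

/-- The weight `G(m) = t^{ω(m)}` for `0 ≤ t ≤ 1 ≤ T`: nonnegative, `G(1) = 1`, multiplicative on coprime
arguments, `G(p^v) = t ≤ T^K`, and `G(p) = t`. [folklore] -/
theorem omegaWeight_admissible {t T : ℝ} (ht0 : 0 ≤ t) (ht1 : t ≤ 1) (hT : 1 ≤ T) (K : ℕ) :
    (∀ n : ℕ, 0 ≤ t ^ n.primeFactors.card) ∧ t ^ (1 : ℕ).primeFactors.card = 1 ∧
    (∀ m n : ℕ, m.Coprime n →
        t ^ (m * n).primeFactors.card = t ^ m.primeFactors.card * t ^ n.primeFactors.card) ∧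
    (∀ p : ℕ, p.Prime → ∀ v : ℕ, 1 ≤ v → t ^ (p ^ v).primeFactors.card ≤ T ^ K) ∧
    (∀ p : ℕ, p.Prime → t ^ p.primeFactors.card = t) := by
  refine ⟨fun n => pow_nonneg ht0 _, by simp, fun m n hmn => ?_, fun p hp v hv => ?_, fun p hp => ?_⟩
  · rw [hmn.primeFactors_mul, Finset.card_union_of_disjoint hmn.disjoint_primeFactors, pow_add]
  · rw [Nat.primeFactors_prime_pow (by omega) hp, Finset.card_singleton, pow_one]
    exact ht1.trans (one_le_pow₀ hT)
  · rw [hp.primeFactors, Finset.card_singleton, pow_one]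

/-! ### Pointwise dominations `t^{s_f} ≤ G(F)` -/

/-- `toNat` of a product of nonnegative integers is the product of the `toNat`s. [folklore] -/
theorem toNat_prod_of_nonneg {k : ℕ} (a : Fin k → ℤ) (ha : ∀ i, 0 ≤ a i) :
    (∏ i, a i).toNat = ∏ i, (a i).toNat := by
  have h : ((∏ i, (a i).toNat : ℕ) : ℤ) = ∏ i, a i := by
    rw [Nat.cast_prod]
    exact Finset.prod_congr rfl fun i _ => Int.toNat_of_nonneg (ha i)
  rw [← h, Int.toNat_natCast]

/-- `Σᵢ s(aᵢ) ≤ s_{2k}(∏ᵢ aᵢ)` for positive integers `aᵢ` (`s` = cap `2`, `s_{2k}` = cap `2k`). [folklore] -/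
theorem sum_capped_toNat_le {k : ℕ} (a : Fin k → ℤ) (ha : ∀ i, 0 < a i) :
    ∑ i, ((a i).toNat.factorization.sum fun _ v => min v 2) ≤
      ((∏ i, a i).toNat.factorization.sum fun _ v => min v (2 * k)) := by
  rw [toNat_prod_of_nonneg a fun i => (ha i).le]
  exact sum_capped_le_cappedK (fun i => (a i).toNat) fun i => by have := ha i; omega

/-- `ω(∏ᵢ aᵢ) ≤ Σᵢ s(aᵢ)` for positive integers `aᵢ`: every prime of the product divides a factor and
contributes at least `1` to its capped statistic. [folklore] -/
theorem card_primeFactors_toNat_prod_le {k : ℕ} (a : Fin k → ℤ) (ha : ∀ i, 0 < a i) :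
    (∏ i, a i).toNat.primeFactors.card ≤ ∑ i, ((a i).toNat.factorization.sum fun _ v => min v 2) := by
  classical
  rw [toNat_prod_of_nonneg a fun i => (ha i).le]
  have hne : ∀ i, (a i).toNat ≠ 0 := fun i => by have := ha i; omega
  have hsub : (∏ i, (a i).toNat).primeFactors ⊆
      Finset.univ.biUnion fun i => (a i).toNat.primeFactors := by
    intro p hp
    have hpp := Nat.prime_of_mem_primeFactors hp
    obtain ⟨i, -, hi⟩ := (hpp.prime.dvd_finsetProd_iff _).1 (Nat.dvd_of_mem_primeFactors hp)
    exact Finset.mem_biUnion.2 ⟨i, Finset.mem_univ _, Nat.mem_primeFactors.2 ⟨hpp, hi, hne i⟩⟩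
  calc (∏ i, (a i).toNat).primeFactors.card
        ≤ (Finset.univ.biUnion fun i => (a i).toNat.primeFactors).card := Finset.card_le_card hsub
    _ ≤ ∑ i, (a i).toNat.primeFactors.card := Finset.card_biUnion_le
    _ ≤ _ := Finset.sum_le_sum fun i _ =>
        Summit.Parity.BatemanHorn.Theorems.AlmostPrimeZerosExtraction.card_primeFactors_le_factorization_sum_min_two _

/-! ### Mertens along the system, both directions -/

/-- **Two-sided Mertens along a Bateman–Horn system**: `|Σ_{p ≤ N} ρ_f(p)/p − k log log N| ≤ C` for `N ≥ 2`
(upper: `exists_sum_rootCount_div_le`; lower: `Σ_p (k − ρ_f(p))/p` converges, hence is bounded above, and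
`Σ_{p≤N} 1/p ≥ log log N + B₁ − 8/log 2` by Mertens' second theorem with rate). [folklore] -/
theorem abs_systemMertens_sub_le {k : ℕ} {f : Fin k → ℤ[X]} (hf : IsBatemanHornSystem f) :
    ∃ C : ℝ, 0 ≤ C ∧ ∀ N : ℕ, 2 ≤ N →
      |∑ p ∈ Nat.primesLE N, (polyRootCountMod f p : ℝ) / p - k * Real.log (Real.log N)| ≤ C := by
  obtain ⟨Cu, hCu⟩ := exists_sum_rootCount_div_le hf
  obtain ⟨L, hL⟩ := AZFG2020_tendsto_sum_sub_omega_div_holds k f hf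
  obtain ⟨B, hB⟩ := hL.bddAbove_range
  set c : ℝ := |Literature.NumberTheory.LFunctions.Mertens.meisselMertens| + 8 / Real.log 2 with hc
  have hk0 : (0 : ℝ) ≤ k := Nat.cast_nonneg _
  refine ⟨max |Cu| (|B| + k * c), le_max_of_le_left (abs_nonneg _), fun N hN => ?_⟩
  have hN' : (2 : ℝ) ≤ N := by exact_mod_cast hN
  have hup := hCu N hN
  have h1 : ∑ p ∈ Nat.primesLE N, ((k : ℝ) - polyRootCountMod f p) / p ≤ B := hB ⟨N, rfl⟩
  have h3 : ∑ p ∈ Nat.primesLE N, ((k : ℝ) - polyRootCountMod f p) / p =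
      k * ∑ p ∈ Nat.primesLE N, (1 : ℝ) / p - ∑ p ∈ Nat.primesLE N, (polyRootCountMod f p : ℝ) / p := by
    rw [Finset.mul_sum, ← Finset.sum_sub_distrib]
    refine Finset.sum_congr rfl fun p _ => ?_
    ring
  have hmert : Real.log (Real.log N) - c ≤ ∑ p ∈ Nat.primesLE N, (1 : ℝ) / p := by
    have hm := Literature.NumberTheory.LFunctions.Mertens.abs_primeRecipSum_sub_le hN'
    rw [Literature.NumberTheory.LFunctions.Mertens.primeRecipSum, Nat.floor_natCast] at hm
    have h8 : 8 / Real.log N ≤ 8 / Real.log 2 :=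
      div_le_div_of_nonneg_left (by norm_num) (Real.log_pos one_lt_two) (Real.log_le_log two_pos hN')
    have hlow := (abs_le.1 (hm.trans h8)).1
    have hB1 := neg_abs_le Literature.NumberTheory.LFunctions.Mertens.meisselMertens
    simp only [one_div]
    linarith
  rw [h3] at h1
  have hkm := mul_le_mul_of_nonneg_left hmert hk0
  rw [abs_le]
  constructor
  · have hmax := le_max_right |Cu| (|B| + k * c)
    have hBabs := le_abs_self B
    linarith
  · linarith [le_max_left |Cu| (|B| + k * c), le_abs_self Cu]

/-- Sign bookkeeping for the exponent: from `|S − kℓ| ≤ C`, `0 < t ≤ T`, `T ≥ 1`: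
`(t − 1)·S ≤ k(t − 1)ℓ + T·C`. [folklore] -/
theorem sub_one_mul_le_of_abs_sub_le {S ℓ C t T : ℝ} (k : ℕ) (hC : 0 ≤ C) (hS : |S - k * ℓ| ≤ C)
    (ht : 0 < t) (htT : t ≤ T) (hT : 1 ≤ T) :
    (t - 1) * S ≤ k * (t - 1) * ℓ + T * C := by
  obtain ⟨h1, h2⟩ := abs_le.1 hS
  rcases le_or_gt 1 t with ht1 | ht1
  · have h3 : (t - 1) * S ≤ (t - 1) * (k * ℓ + C) :=
      mul_le_mul_of_nonneg_left (by linarith) (by linarith)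
    have h4 : (t - 1) * C ≤ T * C := mul_le_mul_of_nonneg_right (by linarith) hC
    linarith
  · have h3 : (t - 1) * S ≤ (t - 1) * (k * ℓ - C) :=
      mul_le_mul_of_nonpos_left (by linarith) (by linarith)
    have h4 : (1 - t) * C ≤ T * C := mul_le_mul_of_nonneg_right (by linarith) hC
    linarith

/-! ### Thresholds and the assembly -/

/-- `(log x)^k ≤ x` for all large `x ∈ ℕ`. [folklore] -/
theorem exists_nat_pow_log_le (k : ℕ) : ∃ x₂ : ℕ, ∀ x : ℕ, x₂ ≤ x → Real.log (x : ℝ) ^ k ≤ (x : ℝ) := by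
  have h : ∀ᶠ y : ℝ in atTop, Real.log y ^ k ≤ y := by
    filter_upwards [(Real.isLittleO_pow_log_id_atTop (n := k)).eventuallyLE, eventually_ge_atTop 0]
      with y hy hy0
    simp only [Real.norm_eq_abs, id_eq] at hy
    rw [abs_of_nonneg hy0] at hy
    exact (le_abs_self _).trans hy
  obtain ⟨x₂, hx₂⟩ := Filter.eventually_atTop.1 (tendsto_natCast_atTop_atTop.eventually h)
  exact ⟨x₂, hx₂⟩

/-- **Assembly**: a bound `Σ_{1 ≤ m ≤ N} t^{s(m + n₀)} ≤ C₀ N (log N)^{k(t−1)}` for the shifted statistic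
(all `N ≥ 2`, uniformly in `0 < t ≤ T`) gives `Σ_{0 ≤ n ≤ x} t^{s(n)} ≤ A x (log x)^{k(t−1)}` for `x ≥ x₀`:
the `n ≤ n₀` terms are at most `Σ_{n ≤ n₀} T^{s(n)}`, absorbed by `x (log x)^{k(t−1)} ≥ x (log x)^{−k} ≥ 1`. [folklore] -/
theorem assemble_of_shifted {k : ℕ} {T : ℝ} (hT : 1 ≤ T) (s : ℕ → ℕ) (n₀ : ℕ) (C₀ : ℝ)
    (hB : ∀ N : ℕ, 2 ≤ N → ∀ t : ℝ, 0 < t → t ≤ T →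
      ∑ m ∈ Finset.Icc 1 N, t ^ (s (m + n₀)) ≤ C₀ * N * Real.log N ^ ((k : ℝ) * (t - 1))) :
    ∃ A : ℝ, ∃ x₀ : ℕ, ∀ x : ℕ, x₀ ≤ x → ∀ t : ℝ, 0 < t → t ≤ T →
      ∑ n ∈ Finset.range (x + 1), t ^ (s n) ≤ A * (x : ℝ) * Real.log (x : ℝ) ^ ((k : ℝ) * (t - 1)) := by
  obtain ⟨x₂, hx₂⟩ := exists_nat_pow_log_le k
  have hT0 : 0 ≤ T := zero_le_one.trans hT
  set J : ℝ := ∑ n ∈ Finset.range (n₀ + 1), T ^ (s n) with hJ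
  have hJ0 : 0 ≤ J := Finset.sum_nonneg fun n _ => pow_nonneg hT0 _
  refine ⟨J + C₀, max x₂ 3, fun x hx t ht htT => ?_⟩
  have hx2 : x₂ ≤ x := le_of_max_le_left hx
  have hx3 : 3 ≤ x := le_of_max_le_right hx
  have hxR : (3 : ℝ) ≤ x := by exact_mod_cast hx3
  have hlog1 : 1 ≤ Real.log x :=
    (Summit.Parity.BatemanHorn.Theorems.AlmostPrimeZerosExtraction.log_facts_of_three_le hxR).1
  set L : ℝ := Real.log (x : ℝ) ^ ((k : ℝ) * (t - 1)) with hL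
  have hxL : 1 ≤ (x : ℝ) * L := by
    have h1 : Real.log x ^ (-(k : ℝ)) ≤ L :=
      Real.rpow_le_rpow_of_exponent_le hlog1 (by nlinarith [ht.le, (Nat.cast_nonneg k : (0 : ℝ) ≤ k)])
    have h2 : Real.log x ^ (-(k : ℝ)) = (Real.log x ^ k)⁻¹ := by
      rw [Real.rpow_neg (by linarith), Real.rpow_natCast]
    have h4 : 0 < Real.log x ^ k := pow_pos (by linarith) k
    calc (1 : ℝ) ≤ x * (Real.log x ^ k)⁻¹ := by
          rw [← div_eq_mul_inv, le_div_iff₀ h4, one_mul]; exact hx₂ x hx2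
      _ ≤ x * L := by rw [← h2]; exact mul_le_mul_of_nonneg_left h1 (Nat.cast_nonneg _)
  have hsplit : Finset.range (x + 1) ⊆
      Finset.range (n₀ + 1) ∪ (Finset.Icc 1 x).map (addRightEmbedding n₀) := by
    intro n hn
    rw [Finset.map_add_right_Icc]
    simp only [Finset.mem_union, Finset.mem_range, Finset.mem_Icc] at hn ⊢
    omega
  have hdisj : Disjoint (Finset.range (n₀ + 1)) ((Finset.Icc 1 x).map (addRightEmbedding n₀)) := by
    rw [Finset.map_add_right_Icc, Finset.disjoint_left]
    intro n h1 h2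
    rw [Finset.mem_range] at h1
    rw [Finset.mem_Icc] at h2
    omega
  calc ∑ n ∈ Finset.range (x + 1), t ^ (s n)
      ≤ ∑ n ∈ Finset.range (n₀ + 1) ∪ (Finset.Icc 1 x).map (addRightEmbedding n₀), t ^ (s n) :=
        Finset.sum_le_sum_of_subset_of_nonneg hsplit fun n _ _ => pow_nonneg ht.le _
    _ = ∑ n ∈ Finset.range (n₀ + 1), t ^ (s n) + ∑ m ∈ Finset.Icc 1 x, t ^ (s (m + n₀)) := by
        rw [Finset.sum_union hdisj, Finset.sum_map]
        simp only [addRightEmbedding_apply]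
    _ ≤ J + C₀ * x * L :=
        add_le_add (Finset.sum_le_sum fun n _ => pow_le_pow_left₀ ht.le htT _) (hB x (by omega) t ht htT)
    _ ≤ J * (x * L) + C₀ * x * L := by
        gcongr
        exact le_mul_of_one_le_right hJ0 hxL
    _ = (J + C₀) * x * L := by ring

/-! ### Nair–Tenenbaum light along the shifted product polynomial -/

/-- **The shifted Nair bound.**  Under the Nair–Tenenbaum-light hypothesis `HN`, for a Bateman–Horn system of
`k ≥ 1` polynomials and `T ≥ 1` there are `n₀, C₀` with
`Σ_{1 ≤ m ≤ N} t^{s_f(m + n₀)} ≤ C₀ N (log N)^{k(t−1)}` for all `N ≥ 2`, uniformly in `0 < t ≤ T`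
(`HN` on `F = (∏ fᵢ)(X + n₀)` with the capped weight for `t ≥ 1` and `t^ω` for `t < 1`; two-sided
Mertens along the system for the exponent). [folklore] -/
theorem shifted_nair_bound
    (hN : ∀ (F : ℤ[X]) (D M : ℕ) (A : ℝ), 1 ≤ F.natDegree → (∀ n : ℕ, 1 ≤ n → 0 < F.eval (n : ℤ)) →
      (∀ p : ℕ, p.Prime → polyRootCountMod ![F] p ≤ D) → 1 ≤ D →
      (∀ p : ℕ, p.Prime → polyRootCountMod ![F] p < p) →
      (∀ p : ℕ, p.Prime → ∀ a : ℕ, 1 ≤ a → polyRootCountMod ![F] (p ^ a) ≤ M) → 1 ≤ M → 1 ≤ A →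
      ∃ C : ℝ, 0 < C ∧ ∀ G : ℕ → ℝ, (∀ n, 0 ≤ G n) → G 1 = 1 →
        (∀ m n : ℕ, m.Coprime n → G (m * n) = G m * G n) →
        (∀ p : ℕ, p.Prime → ∀ v : ℕ, 1 ≤ v → G (p ^ v) ≤ A) → ∀ N : ℕ, 2 ≤ N →
        ∑ n ∈ Finset.Icc 1 N, G (F.eval (n : ℤ)).toNat ≤
          C * N * Real.exp (∑ p ∈ Nat.primesLE N, (G p - 1) * polyRootCountMod ![F] p / p))
    {k : ℕ} {f : Fin k → ℤ[X]} (hf : IsBatemanHornSystem f) (hk : 1 ≤ k) {T : ℝ} (hT : 1 ≤ T) :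
    ∃ n₀ : ℕ, ∃ C₀ : ℝ, ∀ N : ℕ, 2 ≤ N → ∀ t : ℝ, 0 < t → t ≤ T →
      ∑ m ∈ Finset.Icc 1 N,
          t ^ (∑ i, (((f i).eval ((m + n₀ : ℕ) : ℤ)).toNat.factorization.sum fun _ v => min v 2)) ≤
        C₀ * N * Real.log N ^ ((k : ℝ) * (t - 1)) := by
  classical
  obtain ⟨n₀, hn₀⟩ := exists_forall_two_le_eval' hf
  obtain ⟨M, hM1, hM⟩ := exists_rootCount_prod_prime_pow_le hf hk
  obtain ⟨C₁, hC₁0, hC₁⟩ := abs_systemMertens_sub_le hf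
  set P : ℤ[X] := ∏ i, f i with hP
  set F : ℤ[X] := P.comp (X + C (n₀ : ℤ)) with hF
  have hdegP : P.natDegree = ∑ i, (f i).natDegree := natDegree_prod_eq hf
  have hD1 : 1 ≤ ∑ i, (f i).natDegree := by
    have i : Fin k := ⟨0, hk⟩
    calc 1 ≤ (f i).natDegree := hf.natDegree_pos i
      _ ≤ ∑ j, (f j).natDegree :=
        Finset.single_le_sum (fun j _ => Nat.zero_le ((f j).natDegree)) (Finset.mem_univ i)
  have hdegP1 : 1 ≤ P.natDegree := by rw [hdegP]; exact hD1
  have hdegF : 1 ≤ F.natDegree := by rw [hF, natDegree_comp_X_add]; exact hdegP1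
  have hevalF : ∀ m : ℕ, F.eval (m : ℤ) = ∏ i, (f i).eval ((m + n₀ : ℕ) : ℤ) := fun m => by
    rw [hF, eval_comp_X_add, hP, eval_prod]
  have hpos2 : ∀ m : ℕ, ∀ i, (2 : ℤ) ≤ (f i).eval ((m + n₀ : ℕ) : ℤ) := fun m i =>
    hn₀ _ (Nat.le_add_left _ _) i
  have hpos' : ∀ m : ℕ, ∀ i, (0 : ℤ) < (f i).eval ((m + n₀ : ℕ) : ℤ) := fun m i =>
    lt_of_lt_of_le two_pos (hpos2 m i)
  have hposF : ∀ m : ℕ, 1 ≤ m → 0 < F.eval (m : ℤ) := fun m _ => by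
    rw [hevalF]; exact Finset.prod_pos fun i _ => hpos' m i
  have hρF : ∀ m, polyRootCountMod ![F] m = polyRootCountMod f m := fun m => by
    rw [hF, polyRootCountMod_comp_X_add, hP, ← PolyPrimeCountBrun.polyRootCountMod_eq_single_prod]
  have hD : ∀ p : ℕ, p.Prime → polyRootCountMod ![F] p ≤ ∑ i, (f i).natDegree := fun p hp => by
    rw [hρF, PolyPrimeCountBrun.polyRootCountMod_eq_single_prod]; exact rootCount_prod_le_totalDegree hf hp
  have hlt : ∀ p : ℕ, p.Prime → polyRootCountMod ![F] p < p := fun p hp => by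
    rw [hρF]; exact hf.hasNoFixedPrimeDivisor p hp
  have hMF : ∀ p : ℕ, p.Prime → ∀ a : ℕ, 1 ≤ a → polyRootCountMod ![F] (p ^ a) ≤ P.natDegree * M :=
    fun p hp a _ => by rw [hF, polyRootCountMod_comp_X_add]; exact hM p hp a
  have hM1' : 1 ≤ P.natDegree * M := one_le_mul_of_one_le_of_one_le hdegP1 hM1
  have hA : (1 : ℝ) ≤ T ^ (2 * k) := one_le_pow₀ hT
  obtain ⟨Cn, hCn, hmain⟩ := hN F _ _ _ hdegF hposF hD hD1 hlt hMF hM1' hA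
  refine ⟨n₀, Cn * Real.exp (T * C₁), fun N hN2 t ht htT => ?_⟩
  have hN1 : (1 : ℝ) < N := by exact_mod_cast (show 1 < N by omega)
  have hlogN : 0 < Real.log N := Real.log_pos hN1
  -- the common endgame, for any admissible weight `G` with `G(p) = t` dominating `t^{s_f}` pointwise
  have key : ∀ G : ℕ → ℝ, (∀ n, 0 ≤ G n) → G 1 = 1 → (∀ m n : ℕ, m.Coprime n → G (m * n) = G m * G n) →
      (∀ p : ℕ, p.Prime → ∀ v : ℕ, 1 ≤ v → G (p ^ v) ≤ T ^ (2 * k)) → (∀ p : ℕ, p.Prime → G p = t) →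
      (∀ m : ℕ, t ^ (∑ i, (((f i).eval ((m + n₀ : ℕ) : ℤ)).toNat.factorization.sum fun _ v => min v 2)) ≤
        G (∏ i, (f i).eval ((m + n₀ : ℕ) : ℤ)).toNat) →
      ∑ m ∈ Finset.Icc 1 N,
          t ^ (∑ i, (((f i).eval ((m + n₀ : ℕ) : ℤ)).toNat.factorization.sum fun _ v => min v 2)) ≤
        Cn * Real.exp (T * C₁) * N * Real.log N ^ ((k : ℝ) * (t - 1)) := by
    intro G hG0 hG1 hGmul hGA hGp hdom
    have h1 := hmain G hG0 hG1 hGmul hGA N hN2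
    have hexp : ∑ p ∈ Nat.primesLE N, (G p - 1) * (polyRootCountMod ![F] p : ℝ) / p =
        (t - 1) * ∑ p ∈ Nat.primesLE N, (polyRootCountMod f p : ℝ) / p := by
      rw [Finset.mul_sum]
      refine Finset.sum_congr rfl fun p hp => ?_
      rw [hGp p (Nat.prime_of_mem_primesLE hp), hρF, mul_div_assoc]
    have hE := sub_one_mul_le_of_abs_sub_le k hC₁0 (hC₁ N hN2) ht htT hT
    calc ∑ m ∈ Finset.Icc 1 N,
            t ^ (∑ i, (((f i).eval ((m + n₀ : ℕ) : ℤ)).toNat.factorization.sum fun _ v => min v 2))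
        ≤ ∑ m ∈ Finset.Icc 1 N, G (F.eval (m : ℤ)).toNat :=
          Finset.sum_le_sum fun m _ => by rw [hevalF]; exact hdom m
      _ ≤ Cn * N * Real.exp (∑ p ∈ Nat.primesLE N, (G p - 1) * polyRootCountMod ![F] p / p) := h1
      _ = Cn * N * Real.exp ((t - 1) * ∑ p ∈ Nat.primesLE N, (polyRootCountMod f p : ℝ) / p) := by
          rw [hexp]
      _ ≤ Cn * N * Real.exp (k * (t - 1) * Real.log (Real.log N) + T * C₁) := by gcongr
      _ = Cn * Real.exp (T * C₁) * N * Real.log N ^ ((k : ℝ) * (t - 1)) := by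
          rw [Real.exp_add, Real.rpow_def_of_pos hlogN,
            show Real.log (Real.log N) * ((k : ℝ) * (t - 1)) = k * (t - 1) * Real.log (Real.log N) by ring]
          ring
  rcases le_or_gt 1 t with ht1 | ht1
  · -- `t ≥ 1`: the capped weight `t^{Σ_p min(v_p, 2k)}`
    obtain ⟨w0, w1, wmul, wA, wp⟩ := cappedWeight_admissible (K := 2 * k) (by omega) ht1 htT
    refine key (fun n => t ^ (n.factorization.sum fun _ v => min v (2 * k))) w0 w1 wmul wA wp fun m => ?_
    exact pow_le_pow_right₀ ht1 (sum_capped_toNat_le _ (hpos' m))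
  · -- `t < 1`: the weight `t^{ω}`
    obtain ⟨w0, w1, wmul, wA, wp⟩ := omegaWeight_admissible ht.le ht1.le hT (2 * k)
    refine key (fun n => t ^ n.primeFactors.card) w0 w1 wmul wA wp fun m => ?_
    exact pow_le_pow_of_le_one ht.le ht1.le (card_primeFactors_toNat_prod_le _ (hpos' m))

end RealAxisNair

/-- **Stub `stub_realAxisFixedIntervalOfNair` (R-fixed from Nair–Tenenbaum light).**  The hypothesis is,
verbatim, the registered closing form `nairTenenbaumLight` of the sibling crux stmt-Parity-11292: for `F ∈ ℤ[X]`
of degree `≥ 1`, positive on `ℕ_{≥1}`, root counts `ρ_F(p) ≤ D`, `ρ_F(p) < p`, `ρ_F(p^a) ≤ M`, and every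
weight `G ≥ 0`, `G(1) = 1`, multiplicative on coprime arguments with `G(p^v) ≤ A`:
`Σ_{1≤n≤N} G(F(n)) ≤ C·N·exp(Σ_{p≤N} (G(p) − 1)ρ_F(p)/p)` with `C = C(F, D, M, A)` chosen BEFORE `G`.
Conclusion (`stub_realAxisFixedInterval`): for every Bateman–Horn system and every `T ≥ 1`,
`Σ_{0≤n≤x} t^{s_f(n)} ≤ A·x·(log x)^{k(t−1)}` for `x ≥ x₀`, uniformly in `0 < t ≤ T`.
Route: `k = 0` is `x + 1 ≤ 2x`; for `k ≥ 1`, `RealAxisNair.shifted_nair_bound` (shift `n ↦ m + n₀`,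
`F = (∏ fᵢ)(X + n₀)`, weights `t^{min(·,2k)-capped}` / `t^{ω}`, two-sided Mertens along the system) and
`RealAxisNair.assemble_of_shifted`. [folklore] -/
theorem stub_realAxisFixedIntervalOfNair :
    (∀ (F : ℤ[X]) (D M : ℕ) (A : ℝ), 1 ≤ F.natDegree → (∀ n : ℕ, 1 ≤ n → 0 < F.eval (n : ℤ)) →
      (∀ p : ℕ, p.Prime → polyRootCountMod ![F] p ≤ D) → 1 ≤ D →
      (∀ p : ℕ, p.Prime → polyRootCountMod ![F] p < p) →
      (∀ p : ℕ, p.Prime → ∀ a : ℕ, 1 ≤ a → polyRootCountMod ![F] (p ^ a) ≤ M) → 1 ≤ M → 1 ≤ A →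
      ∃ C : ℝ, 0 < C ∧ ∀ G : ℕ → ℝ, (∀ n, 0 ≤ G n) → G 1 = 1 →
        (∀ m n : ℕ, m.Coprime n → G (m * n) = G m * G n) →
        (∀ p : ℕ, p.Prime → ∀ v : ℕ, 1 ≤ v → G (p ^ v) ≤ A) → ∀ N : ℕ, 2 ≤ N →
        ∑ n ∈ Finset.Icc 1 N, G (F.eval (n : ℤ)).toNat ≤
          C * N * Real.exp (∑ p ∈ Nat.primesLE N, (G p - 1) * polyRootCountMod ![F] p / p)) →
    ∀ (k : ℕ) (f : Fin k → Polynomial ℤ), Literature.NumberTheory.Sieve.IsBatemanHornSystem f →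
      ∀ T : ℝ, 1 ≤ T → ∃ A : ℝ, ∃ x₀ : ℕ, ∀ x : ℕ, x₀ ≤ x → ∀ t : ℝ, 0 < t → t ≤ T →
        (∑ n ∈ Finset.range (x + 1), t ^ (∑ i, (((f i).eval (n : ℤ)).toNat.factorization.sum fun _ v => min v 2))) ≤
          A * (x : ℝ) * (Real.log (x : ℝ)) ^ ((k : ℝ) * (t - 1)) := by
  intro hN k f hf T hT
  rcases Nat.eq_zero_or_pos k with rfl | hk
  · refine ⟨2, 1, fun x hx t _ _ => ?_⟩
    have hx' : (1 : ℝ) ≤ (x : ℝ) := by exact_mod_cast hx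
    simp only [Finset.univ_eq_empty, Finset.sum_empty, pow_zero, Finset.sum_const, Finset.card_range,
      nsmul_eq_mul, mul_one, Nat.cast_zero, zero_mul, Real.rpow_zero]
    push_cast
    linarith
  · obtain ⟨n₀, C₀, hB⟩ := RealAxisNair.shifted_nair_bound hN hf hk hT
    exact RealAxisNair.assemble_of_shifted hT
      (fun n : ℕ => ∑ i, (((f i).eval (n : ℤ)).toNat.factorization.sum fun _ v => min v 2)) n₀ C₀ hB

end Summit.Parity.BatemanHorn.Cruxes.DiscMajorantLog.Sketch

end
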